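import Mathlib
import Summits.CriticalPhenomena.PercolationContinuityZ3.Theorems.PercNearOneGluingNoHeavyLowerTailOrderedDifferences
import Summits.CriticalPhenomena.PercolationContinuityZ3.Theorems.PercNearOneGluingNoHeavyLowerTailAntipodalStrongHarris

/-!
# The ordered-certificate socket for a PAIR of labellings (node certificates of the hybrid recursion)

Helper file for crux `stmt-CriticalPhenomena-4575` (`NoHeavyLowerTail`, route `PercNearOneGluingNoHeavy`), hull-port seat
`prim-hp-7` (generation 54); `--supports stmt-CriticalPhenomena-4575`.  Everything here is PROVED; no definitions.

This is prim-ineq-gen-3's socket `OrientedAntipodalHall.card_le_card_goods_above_of_orderedTwoSided` (file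
`…OrientedAntipodalHallTwoSidedCertificate`, gen 16) with the single labelling `f` replaced by a PAIR `(g, h)`: the goods of the
pair on `S` are the `U ⊆ S` with `g U = A` and `h (S \ U) = B`, the certified co-goods are the `Z ⊆ S` with `h Z = B`,
`g (S \ Z) = A`, disjoint from a member of `D`.  No hypothesis on `D` is needed beyond `X ⊆ S` (the family members only serve as
anchors of the goods), none on `g, h` beyond `h ∅ = B` and `g S = A` (so that the empty difference is a co-good); monotonicity is
NOT used.  Purpose (memo `prim-hp-7/FROM-prim-hp-7-g54-THREE-PETALS.md` §8): at a node `(R, A_g, A_h)` of the section recursion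
(`…OrientedAntipodalHallSectionDecomposition`, `…SDCert`) the goods are exactly the pair-goods of `g = f (· ∪ A_g)`,
`h = f (· ∪ A_h)` on `S \ R`, so this socket closes nodes of the HYBRID certificate (Conjecture H: no failure in 1.1·10⁸ random
co-intersecting families; it certifies the seven known Hall-true families without an antipodal certificate).  With `g = h = f`
it is the original socket (up to the derivation of `f ∅ = B`, `f S = A` from a bad).  (prim-hp-7 gen 54, 2026-08-22.)
-/

namespace Summit.CriticalPhenomena.PercolationContinuityZ3.Theorems

namespace OrientedAntipodalHall

open Finset AntipodalStrongHarris AntipodalStrongHarris.Lab OrderedDifferences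
open scoped FinsetFamily

variable {α : Type*} [DecidableEq α] {k : ℕ}

/-- **Pair-labelling socket: an ordered two-sided family certifies the Hall count for the goods of a pair `(g, h)`.**  `D` a
family of subsets of `S` (the anchors), `M X` a member set for each `X ∈ D` and `P` a finite family of pseudo-sets, with ranks
`ρM`, `ρP` into a linear order such that for every two distinct elements `U, V` of `M(D) ∪ P` with `rank U ≤ rank V`: `U ⊄ V`, and
`U \ V` is a pseudo-set or a certified co-good (`Z ⊆ S`, `h Z = B`, `g (S \ Z) = A`, `Z` disjoint from some `X ∈ D`).  If
`h ∅ = B` and `g S = A`, then `#D ≤ #{U ⊆ S : g U = A, h (S \ U) = B, U ⊇ some X ∈ D}`. [this work; single-labelling original: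
prim-ineq-gen-3's `card_le_card_goods_above_of_orderedTwoSided`] -/
theorem card_le_card_pairGoods_above_of_orderedTwoSided (S : Finset α) (g h : Finset α → Lab k)
    (hh : h ∅ = bot) (hg : g S = top) (D : Finset (Finset α)) (hDS : ∀ X ∈ D, X ⊆ S)
    (M : Finset α → Finset α) (P : Finset (Finset α))
    {β : Type*} [LinearOrder β] (ρM ρP : Finset α → β)
    (hMM : ∀ X ∈ D, ∀ X' ∈ D, X ≠ X' → ρM X ≤ ρM X' → ¬ M X ⊆ M X' ∧ (M X \ M X' ∈ P ∨
      (M X \ M X' ⊆ S ∧ h (M X \ M X') = bot ∧ g (S \ (M X \ M X')) = top ∧ ∃ Y ∈ D, Disjoint (M X \ M X') Y)))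
    (hMP : ∀ X ∈ D, ∀ E ∈ P,
      (ρM X ≤ ρP E → ¬ M X ⊆ E ∧ (M X \ E ∈ P ∨
        (M X \ E ⊆ S ∧ h (M X \ E) = bot ∧ g (S \ (M X \ E)) = top ∧ ∃ Y ∈ D, Disjoint (M X \ E) Y))) ∧
      (ρP E ≤ ρM X → ¬ E ⊆ M X ∧ (E \ M X ∈ P ∨
        (E \ M X ⊆ S ∧ h (E \ M X) = bot ∧ g (S \ (E \ M X)) = top ∧ ∃ Y ∈ D, Disjoint (E \ M X) Y))))
    (hPP : ∀ E ∈ P, ∀ E' ∈ P, E ≠ E' → ρP E ≤ ρP E' → ¬ E ⊆ E' ∧ (E \ E' ∈ P ∨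
      (E \ E' ⊆ S ∧ h (E \ E') = bot ∧ g (S \ (E \ E')) = top ∧ ∃ Y ∈ D, Disjoint (E \ E') Y))) :
    #D ≤ #{U ∈ S.powerset | g U = top ∧ h (S \ U) = bot ∧ ∃ X ∈ D, X ⊆ U} := by
  classical
  rcases D.eq_empty_or_nonempty with rfl | ⟨X₀, hX₀⟩
  · simp
  set K : Finset (Finset α) := {F ∈ S.powerset | h F = bot ∧ g (S \ F) = top ∧ ∃ Y ∈ D, Disjoint F Y} with hK
  have hKmem : ∀ Z, (Z ⊆ S ∧ h Z = bot ∧ g (S \ Z) = top ∧ ∃ Y ∈ D, Disjoint Z Y) → Z ∈ K ∪ P := by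
    rintro Z ⟨hZS, hZb, hZt, hZY⟩
    exact mem_union_left _ (by rw [hK, mem_filter, mem_powerset]; exact ⟨hZS, hZb, hZt, hZY⟩)
  have hempty : (∅ : Finset α) ∈ K ∪ P := by
    refine hKmem ∅ ⟨empty_subset _, hh, ?_, X₀, hX₀, disjoint_empty_left _⟩
    rw [sdiff_empty]; exact hg
  -- the indexed family: members of `D` and pseudo-sets
  let A : D ⊕ P → Finset α := Sum.elim (fun X => M X.1) (fun E => E.1)
  let r : D ⊕ P → β := Sum.elim (fun X => ρM X.1) (fun E => ρP E.1)
  have hA : ∀ ⦃x y : D ⊕ P⦄, x ≠ y → r x ≤ r y → ¬ A x ⊆ A y := by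
    rintro (⟨X, hX⟩ | ⟨E, hE⟩) (⟨X', hX'⟩ | ⟨E', hE'⟩) hne hle
    · have hXX : X ≠ X' := fun h => hne (by subst h; rfl)
      exact (hMM X hX X' hX' hXX hle).1
    · exact ((hMP X hX E' hE').1 hle).1
    · exact ((hMP X' hX' E hE).2 hle).1
    · have hEE : E ≠ E' := fun h => hne (by subst h; rfl)
      exact (hPP E hE E' hE' hEE hle).1
  have hT : ∀ ⦃x y : D ⊕ P⦄, r x ≤ r y → A x \ A y ∈ K ∪ P := by
    intro x y hle
    by_cases hxy : x = y
    · subst hxy; rw [sdiff_self]; exact hempty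
    rcases x with ⟨X, hX⟩ | ⟨E, hE⟩ <;> rcases y with ⟨X', hX'⟩ | ⟨E', hE'⟩
    · have hXX : X ≠ X' := fun h => hxy (by subst h; rfl)
      rcases (hMM X hX X' hX' hXX hle).2 with h | h
      · exact mem_union_right _ h
      · exact hKmem _ h
    · rcases ((hMP X hX E' hE').1 hle).2 with h | h
      · exact mem_union_right _ h
      · exact hKmem _ h
    · rcases ((hMP X' hX' E hE).2 hle).2 with h | h
      · exact mem_union_right _ h
      · exact hKmem _ h
    · have hEE : E ≠ E' := fun h => hxy (by subst h; rfl)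
      rcases (hPP E hE E' hE' hEE hle).2 with h | h
      · exact mem_union_right _ h
      · exact hKmem _ h
  have hmain := card_le_card_of_rank A r hA (K ∪ P) hT
  have hcard : Fintype.card (D ⊕ P) = #D + #P := by
    rw [Fintype.card_sum, Fintype.card_coe, Fintype.card_coe]
  have hDK : #D ≤ #K := by
    have h := card_union_le K P
    omega
  -- `K` injects into the goods above `D` by complementation
  have hKS : ∀ F ∈ K, F ⊆ S := by
    intro F hF
    rw [hK, mem_filter, mem_powerset] at hF
    exact hF.1
  have hinjK : Set.InjOn (fun F => S \ F) (K : Set (Finset α)) := by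
    intro F₁ hF₁ F₂ hF₂ h12
    have h₁ := Finset.sdiff_sdiff_eq_self (hKS F₁ hF₁)
    have h₂ := Finset.sdiff_sdiff_eq_self (hKS F₂ hF₂)
    simp only at h12
    rw [← h₁, ← h₂, h12]
  have himg : K.image (fun F => S \ F) ⊆
      {U ∈ S.powerset | g U = top ∧ h (S \ U) = bot ∧ ∃ X ∈ D, X ⊆ U} := by
    intro U hU
    obtain ⟨F, hF, rfl⟩ := mem_image.mp hU
    have hFS := hKS F hF
    rw [hK, mem_filter] at hF
    obtain ⟨-, hFbot, hFtop, X, hX, hFX⟩ := hF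
    rw [mem_filter, mem_powerset, Finset.sdiff_sdiff_eq_self hFS]
    refine ⟨sdiff_subset, hFtop, hFbot, X, hX, ?_⟩
    intro a ha
    exact mem_sdiff.mpr ⟨hDS X hX ha, fun haF => disjoint_left.mp hFX haF ha⟩
  calc #D ≤ #K := hDK
    _ = #(K.image fun F => S \ F) := (card_image_of_injOn hinjK).symm
    _ ≤ #{U ∈ S.powerset | g U = top ∧ h (S \ U) = bot ∧ ∃ X ∈ D, X ⊆ U} := card_le_card himg

end OrientedAntipodalHall

end Summit.CriticalPhenomena.PercolationContinuityZ3.Theorems
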